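import Summits.HodgeConjecture.HodgeConjecture.Theorems.F0P3XiUnramNonsplitInstance    -- ★ `isAdmissible_cmPrincipalSeries`, `Gqs`, `qsForm`, ★ `CMPrincipalSeriesSpherical`, ★ `IrrClass.IsSpherical`
import Literature.NumberTheory.Automorphic.PrincipalSeriesSphericalUnramified           -- ★ `eq_one_of_fixedPoints_cmPrincipalSeries_ne_bot`
import Literature.NumberTheory.Automorphic.HeisenbergChartAtNonsplitPlace               -- ★ `valued_conjLocal_apply_of_smul_eq`
import Summits.HodgeConjecture.HodgeConjecture.Theorems.F0P2oStubDictTorusChar          -- ★ `exists_quotConj_eq_of_nonsplit` (block Hilbert 90 at a non-split place)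
import HarnessLib

/-!
# R90-TF · S5 (Rogawski Ch. 13.3) — (LN) UNRAMIFIED NON-SPLIT ξ-LABEL RIGIDITY: a `K_v`-spherical constituent of `i_G(χ_ξ)` forces `ξ_v = 1`

Cell `hodgecm-mathlib`, crux H413 (`stmt-HodgeConjecture-24833`, lane `--supports … --as helper`), route of record `HCCMUnconditional` (no route verbs;
count-neutral).  Programme R90-TF, section S5 = Ch. 13.3 (base `R90-C133`); seat K2E3-p29 (g2), dealt BY NAME «DEAL #14 → K2E3-p29 (g2): (LN)
`Theorems/R90S5NonsplitXiLabelRigidUnramified.lean`» (R90-C133-plan (g0), R90 bus 2026-09-04T16:14:29Z; row (LN) of R90-C133-p02's DEAL #10 census «`P`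
determines `ξ`», consumer S9 (S-U) ∕ 13.3.7 bookkeeping).  THEOREMS ONLY (no `def`, no instance, no notation, no named fact, no `sorry`); imports ★ only.
HONEST LABEL: HC_CM is proved only modulo the 7 printed citations (2 remaining named inputs: hLiu418 = stmt-HodgeConjecture-24832,
h413 = stmt-HodgeConjecture-24833) until rung 0 closes; this file is unconditional local group theory (closes no socket).

THE DEALT STATEMENT.  «At a non-split `v` with everything unramified, a common SPHERICAL constituent of `i_G(χ_ξ) = cmPrincipalSeries L 3 v (cmXiTorusChar L v μ η₁ η₂)`
and of `i_G(χ_{ξ′})` forces `(η₁, η₂) = (η₁′, η₂′)`» (`ξ = (η₁, η₂)`, `ξ′ = (η₁′, η₂′)` characters of the local norm-one torus `E¹_v = normOneUnits (conjLocal L c v)`,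
[Rogawski1990 §12.2 case (2) p. 174; §13.3]).

THE MATHEMATICS (why no Satake bookkeeping is needed).  `G = U(Φ₃)(L⁺_v)`, `K_v = U(Φ₃)(𝒪_v)` (★ `cmLocalIntegralLevel`), `T` the diagonal torus
`{d(α, β, σ(α)⁻¹)}`, `χ_ξ(d(α, β, σ(α)⁻¹)) = η₁(α/σα) · μ(α) · ‖α‖^{1/2} · η₂(α β σ(α)⁻¹)` (★ `xiTorusChar_apply`).
* (S→U) If an irreducible `c` with a LINE of `K_v`-fixed vectors is a constituent `N₁ ⁄ N₂` of the smooth representation `i_G(χ)`, then `i_G(χ)^{K_v} ≠ 0`: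
  `V ↦ V^{K}` is exact for compact `K` on smooth representations [BernsteinZelevinsky1976 §2.3] (★ `Representation.map_fixedPoints_eq_of_surjective` on
  `N₁ ↠ N₁ ⁄ N₂`), so a fixed line of `c ≅ N₁ ⁄ N₂` lifts to `N₁^{K_v} ⊆ i_G(χ)^{K_v}`.  Hence `χ = 1` on `T ∩ K_v` [CartierCorvallis1979 §III.3–§IV.1; Casselman1980 §3]
  (★ `eq_one_of_fixedPoints_cmPrincipalSeries_ne_bot`: Iwasawa `G = B K_v`, `δ_B = 1` on `B ∩ K_v`).
* (T) Torus witnesses INSIDE `K_v`: `t_β = d(1, β, 1)` for `β ∈ E¹_v` of valuation one and `t_α = d(α, 1, σ(α)⁻¹)` for a unit `α` of valuation one at every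
  `w ∣ v` are integral with integral inverse; `χ_ξ(t_β) = η₂(β)` and `χ_ξ(t_α) = η₁(α/σα) μ(α) ‖α‖^{1/2} η₂(α/σα)`.
* (NS) At a NON-SPLIT `v` EVERY `β ∈ E¹_v` has valuation one (`σ(β) β = 1` and `|σ x|_w = |x|_w`, ★ `valued_conjLocal_apply_of_smul_eq`) — so `η₂ = 1`
  outright, and a character of `E¹_v` that is «unramified» in the tree's sense (trivial on valuation-one units) is TRIVIAL: print's «`ξ_v` unramified»
  at a non-split `v` means `ξ_v = 1` (`U(1)(L⁺_v) = E¹_v` is compact).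
* (H90-units) With `μ` unramified and `‖α‖ = 1` on units (★ `halfModulusChar_eq_one_of_forall_v_eq_one`) we get `η₁(α/σα) = 1` for every unit `α` of
  valuation one; `η₁ = 1` on all of `E¹_v` as soon as every `β ∈ E¹_v` is `α/σ(α)` for such an `α` — true exactly when `L_w/L⁺_v` is UNRAMIFIED
  (Hilbert 90 ★ `exists_quotConj_eq_of_nonsplit`, then rescale by a `σ`-fixed uniformiser; for a RAMIFIED quadratic `L_w/L⁺_v` the index
  `[E¹ : quotConj(𝒪^×)]` is `2` and the sign character gives an unramified `χ_ξ` with `η₁ ≠ 1`, so the hypothesis is necessary).  It is carried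
  hypothesis-first as `hur` (valuation currency).
Consequently ANY `K_v`-spherical constituent of `i_G(χ_ξ)` forces `η₁ = 1 ∧ η₂ = 1`, and two labels `ξ, ξ′` with a common spherical constituent satisfy
`(η₁, η₂) = (1, 1) = (η₁′, η₂′)` — the dealt head.  The `‖·‖^{±1/2}` ∕ `wχ` exclusion of the Satake road never arises: at an unramified non-split `v`
the principal series `i_G(χ_ξ)` does not depend on `ξ`.

* §1 (generic `G`) `fixedPoints_ne_bot_of_isConstituentOf_of_isSpherical`.
* §2 (CM carrier, any finite `v`) `coe_torusU_mem_cmLocalIntegralLevel_of_forall_v_eq_one` (diagonal `d` with `|d_i|_w = 1` ⇒ `diag(d) ∈ K_v`);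
  `cmXiTorusChar_eq_one_of_mem_level_of_isSpherical_constituent` ((S→U) read on `χ_ξ`); `eq_one_of_level_of_v_eq_one` (`η₂(β) = 1`),
  `comp_quotConj_eq_one_of_level_of_v_eq_one` (`η₁(α/σα) = 1`).
* §3 (non-split `v`) `v_coe_normOneUnits_apply_eq_one_of_nonsplit`, `eq_one_of_unramified_normOneUnits_of_nonsplit` (tree-unramified `η` is `1`),
  `eta_eq_one_of_isSpherical_constituent_of_nonsplit` (`η₁ = 1 ∧ η₂ = 1`), and THE DEALT HEAD **`nonsplitXiLabelRigid_unramified`**; the corollary under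
  «`η`'s unramified» `nonsplitXiLabelRigid_of_unramified` (no constituent needed).
Sibling: (LT) ★ `R90S5CmXiTorusCharInjective` (K2E2-p12 (g8): `χ_ξ` determines `ξ` at a non-split `v`); not used here.

## References
* [Rogawski1990] J. D. Rogawski, *Automorphic Representations of Unitary Groups in Three Variables*, Ann. of Math. Stud. 123 (1990): §4.5 p. 45 (`i_G(χ)^K`
  by `G = BK`), §12.1 p. 171 (the torus `d(α, β, ᾱ⁻¹)`), §12.2 pp. 173–174 (case (2), `χ_ξ`, «`πⁿ(ξ_v)` is unramified if `ξ_v` is»), §13.3 (ξ-families).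
* [CartierCorvallis1979] P. Cartier, *Representations of 𝔭-adic groups: a survey*, PSPM 33.1 (1979), §III.3, §IV.1.
* [Casselman1980] W. Casselman, *The unramified principal series of 𝔭-adic groups I*, Compositio Math. 40 (1980), §3.
* [BernsteinZelevinsky1976] I. N. Bernstein, A. V. Zelevinsky, *Representations of the group GL(n,F)*, Russian Math. Surveys 31 (1976), §2.3.
* [CasselsFrohlichANT1967] J. W. S. Cassels, A. Fröhlich (eds.), *Algebraic Number Theory* (1967), Ch. V §2.7 Prop. 5 (Hilbert 90).
-/

set_option autoImplicit false
-- the mandated namespace repeats `HodgeConjecture.HodgeConjecture`, as in every `Theorems/*.lean` of this sub-problem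
set_option linter.dupNamespace false

noncomputable section

open NumberField IsDedekindDomain
open scoped Matrix MatrixGroups

open Literature.NumberTheory.Automorphic Literature.NumberTheory.Automorphic.UnitaryGroup Literature.NumberTheory.Rogawski1990

namespace Summit.HodgeConjecture.HodgeConjecture.R90.S5

/-! ## §1 Generic: a `K`-spherical constituent of a smooth representation lifts to a non-zero `K`-fixed vector -/

section Generic

variable {G : Type*} [Group G] [TopologicalSpace G] [IsTopologicalGroup G]

/-- **(S→U, generic) A `K`-SPHERICAL CONSTITUENT FORCES `ρ^K ≠ 0`**: if `c ∈ Irr(G)` is a constituent `N₁ ⁄ N₂` of the SMOOTH representation `ρ` and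
`c` has a line of `K`-fixed vectors, `K` compact, then `ρ` has a non-zero `K`-fixed vector — `(N₁ ⁄ N₂)^K` is the image of `N₁^K ⊆ ρ^K` (exactness of
`V ↦ V^K`, ★ `Representation.map_fixedPoints_eq_of_surjective`). [cite: BernsteinZelevinsky1976, §2.3] [cite: CartierCorvallis1979, §IV.1] -/
theorem fixedPoints_ne_bot_of_isConstituentOf_of_isSpherical {V : Type*} [AddCommGroup V] [Module ℂ V] {ρ : Representation ℂ G V}
    (hρ : ρ.IsSmooth) {K : Subgroup G} (hKc : IsCompact (K : Set G)) {c : IrrClass G} (hc : c.IsConstituentOf ρ)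
    (hK : c.IsSpherical K) : ρ.fixedPoints K ≠ ⊥ := by
  obtain ⟨r, rfl, N₁, N₂, _, ⟨e⟩⟩ := hc
  -- the subquotient `N₁ ⁄ N₂` as the quotient of `N₁` by the pulled-back subrepresentation `N₂'`
  let N₂' : Subrepresentation N₁.toRepresentation :=
    ⟨N₂.toSubmodule.comap N₁.toSubmodule.subtype, fun g _ hx ↦ N₂.apply_mem_toSubmodule g hx⟩
  have e' : r.ρ.Equiv N₂'.quotientRep := e
  -- a non-zero `K`-fixed vector of `r`
  have hne : r.ρ.fixedPoints K ≠ ⊥ := Representation.IsSpherical.isUnramified ((IrrClass.isSpherical_mk r K).1 hK)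
  obtain ⟨x, hxK, hx0⟩ := (Submodule.ne_bot_iff _).1 hne
  -- its image in `N₁ ⁄ N₂'` is `K`-fixed and non-zero
  have hexK : e' x ∈ N₂'.quotientRep.fixedPoints K := e'.map_mem_fixedPoints K hxK
  have hex0 : e' x ≠ 0 := fun h => hx0 ((map_eq_zero_iff e' (EquivLike.injective e')).1 h)
  -- lift it to `N₁^K` (exactness of `K`-invariants on the smooth `N₁`)
  have hsm₁ : N₁.toRepresentation.IsSmooth := hρ.toRepresentation N₁
  rw [← Representation.map_fixedPoints_eq_of_surjective hsm₁ N₂'.mkQ N₂'.mkQ_surjective hKc] at hexK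
  obtain ⟨y, hyK, hyx⟩ := hexK
  have hy0 : y ≠ 0 := by
    rintro rfl
    exact hex0 (by rw [← hyx, map_zero])
  -- read `y ∈ N₁^K` as a non-zero `K`-fixed vector of `ρ`
  have hyK' : y ∈ N₁.toRepresentation.fixedPoints K := hyK
  rw [Submodule.ne_bot_iff]
  refine ⟨(y : V), ?_, fun h => hy0 (Subtype.ext h)⟩
  rw [Representation.mem_fixedPoints] at hyK' ⊢
  intro g hg
  exact congrArg Subtype.val (hyK' g hg)

end Generic

/-! ## §2 The CM carrier `U(Φ₃)(L⁺_v)` at ANY finite place `v`: torus witnesses in `K_v`, and `χ_ξ = 1` on `T ∩ K_v` from a spherical constituent -/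

section CM

variable (L : Type) [Field L] [NumberField L] [IsCMField L] (v : HeightOneSpectrum (𝓞 ↥(maximalRealSubfield L)))

/-- **A DIAGONAL torus element all of whose entries have valuation one at every `w ∣ v` lies in `K_v = U(Φ₃)(𝒪_v)`** (its entries `d_i`, `0` and those
of its inverse `d_i⁻¹`, `0` are integral; ★ `mem_cmLocalIntegralLevel_iff_forall_v_le_one`). [cite: Rogawski1990, §12.1 p. 171; §4.5 p. 45] [cite: CartierCorvallis1979, §IV.1] -/
theorem coe_torusU_mem_cmLocalIntegralLevel_of_forall_v_eq_one
    (t : ↥(torusU (conjLocal L (IsCMField.complexConj L) v) (cmLocalForm L 3 v))) (d : Fin 3 → (LocalRing L v)ˣ)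
    (hd : glDiagonal 3 (LocalRing L v) d =
      ((t : ↥(unitaryGroupOfForm (conjLocal L (IsCMField.complexConj L) v) (cmLocalForm L 3 v))) : GL (Fin 3) (LocalRing L v)))
    (h : ∀ (i : Fin 3) (w : PlacesOver L v), Valued.v ((d i : LocalRing L v) w) = 1) :
    (t : ↥(unitaryGroupOfForm (conjLocal L (IsCMField.complexConj L) v) (cmLocalForm L 3 v))) ∈ cmLocalIntegralLevel L 3 (qsForm L) v := by
  refine (mem_cmLocalIntegralLevel_iff_forall_v_le_one L 3 v _).2 ⟨fun i j w => ?_, fun i j w => ?_⟩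
  · rw [← hd, coe_glDiagonal, Matrix.diagonal_apply]
    split_ifs with hij
    · exact (h i w).le
    · rw [Pi.zero_apply, map_zero]; exact zero_le
  · rw [Subgroup.coe_inv, ← hd, ← map_inv, coe_glDiagonal, Matrix.diagonal_apply]
    split_ifs with hij
    · rw [Pi.inv_apply]
      exact (v_units_inv_apply_eq_one L v (d i) w (h i w)).le
    · rw [Pi.zero_apply, map_zero]; exact zero_le

/-- **(S→U on `χ_ξ`) A `K_v`-SPHERICAL CONSTITUENT OF `i_G(χ)` FORCES `χ = 1` ON `T ∩ K_v`** (`χ` ANY character of the diagonal torus of `U(Φ₃)(L⁺_v)`, ANY finite `v`):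
§1 on the smooth (indeed admissible, ★ `isAdmissible_cmPrincipalSeries`) `i_G(χ)`, then ★ `eq_one_of_fixedPoints_cmPrincipalSeries_ne_bot`.
[cite: CartierCorvallis1979, §III.3, §IV.1] [cite: Casselman1980, §3] [cite: Rogawski1990, §4.5 p. 45; §12.2 pp. 173–174] -/
theorem eq_one_of_mem_level_of_isSpherical_constituent
    (χ : ↥(torusU (conjLocal L (IsCMField.complexConj L) v) (cmLocalForm L 3 v)) →* ℂˣ)
    {c : IrrClass (Gqs L v)} (hc : c.IsConstituentOf (cmPrincipalSeries L 3 v χ)) (hK : c.IsSpherical (cmLocalIntegralLevel L 3 (qsForm L) v))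
    (t : ↥(torusU (conjLocal L (IsCMField.complexConj L) v) (cmLocalForm L 3 v)))
    (ht : (t : ↥(unitaryGroupOfForm (conjLocal L (IsCMField.complexConj L) v) (cmLocalForm L 3 v))) ∈ cmLocalIntegralLevel L 3 (qsForm L) v) :
    χ t = 1 :=
  eq_one_of_fixedPoints_cmPrincipalSeries_ne_bot L 3 v χ
    (fixedPoints_ne_bot_of_isConstituentOf_of_isSpherical (Cruxes.H413.F0P3XiUnramNonsplitInstance.isAdmissible_cmPrincipalSeries L v χ).isSmooth
      (isCompact_isOpen_cmLocalIntegralLevel L 3 (qsForm L) v).1 hc hK) t ht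

/-- **`η₂(β) = 1` for `β ∈ E¹_v` OF VALUATION ONE, whenever `χ_ξ = 1` on `T ∩ K_v`**: the witness `t_β = d(1, β, 1) ∈ T ∩ K_v` has `χ_ξ(t_β) = η₂(β)`.
[cite: Rogawski1990, §12.1 p. 171; §12.2 p. 174] -/
theorem eq_one_of_level_of_v_eq_one (μ : (LocalRing L v)ˣ →* ℂˣ) (η₁ η₂ : ↥(normOneUnits (conjLocal L (IsCMField.complexConj L) v)) →* ℂˣ)
    (hlev : ∀ t : ↥(torusU (conjLocal L (IsCMField.complexConj L) v) (cmLocalForm L 3 v)),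
      (t : ↥(unitaryGroupOfForm (conjLocal L (IsCMField.complexConj L) v) (cmLocalForm L 3 v))) ∈ cmLocalIntegralLevel L 3 (qsForm L) v →
        cmXiTorusChar L v μ η₁ η₂ t = 1)
    (β : ↥(normOneUnits (conjLocal L (IsCMField.complexConj L) v)))
    (hβ : ∀ w : PlacesOver L v, Valued.v (((β : (LocalRing L v)ˣ) : LocalRing L v) w) = 1) : η₂ β = 1 := by
  let d : Fin 3 → (LocalRing L v)ˣ := ![1, (β : (LocalRing L v)ˣ), 1]
  have hd1 : d 1 = (β : (LocalRing L v)ˣ) := rfl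
  have hd0 : d 0 = 1 := rfl
  have hd2 : d 2 = 1 := rfl
  have hmem : glDiagonal 3 (LocalRing L v) d ∈ unitaryGroupOfForm (conjLocal L (IsCMField.complexConj L) v) (cmLocalForm L 3 v) := by
    rw [cmLocalForm_eq_over, glDiagonal_mem_unitaryGroupOfForm_antidiagonal_iff]
    intro i
    fin_cases i
    · show (conjLocal L (IsCMField.complexConj L) v) ((d 2 : (LocalRing L v)ˣ) : LocalRing L v) * (d 0 : LocalRing L v) = 1
      rw [hd2, hd0, Units.val_one, map_one, one_mul]
    · show (conjLocal L (IsCMField.complexConj L) v) ((d 1 : (LocalRing L v)ˣ) : LocalRing L v) * (d 1 : LocalRing L v) = 1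
      rw [hd1]
      exact (mem_normOneUnits_iff _).1 β.2
    · show (conjLocal L (IsCMField.complexConj L) v) ((d 0 : (LocalRing L v)ˣ) : LocalRing L v) * (d 2 : LocalRing L v) = 1
      rw [hd2, hd0, Units.val_one, map_one, one_mul]
  let t : ↥(torusU (conjLocal L (IsCMField.complexConj L) v) (cmLocalForm L 3 v)) := ⟨⟨glDiagonal 3 (LocalRing L v) d, hmem⟩, ⟨d, rfl⟩⟩
  have hval : ∀ (i : Fin 3) (w : PlacesOver L v), Valued.v ((d i : LocalRing L v) w) = 1 := by
    intro i w
    fin_cases i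
    · show Valued.v (((d 0 : (LocalRing L v)ˣ) : LocalRing L v) w) = 1
      rw [hd0, Units.val_one, Pi.one_apply, map_one]
    · show Valued.v (((d 1 : (LocalRing L v)ˣ) : LocalRing L v) w) = 1
      rw [hd1]; exact hβ w
    · show Valued.v (((d 2 : (LocalRing L v)ˣ) : LocalRing L v) w) = 1
      rw [hd2, Units.val_one, Pi.one_apply, map_one]
  have ht := hlev t (coe_torusU_mem_cmLocalIntegralLevel_of_forall_v_eq_one L v t d rfl hval)
  have h0 : torusEntry (conjLocal L (IsCMField.complexConj L) v) (cmLocalForm L 3 v) 0 t = 1 := by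
    rw [torusEntry_eq_of_glDiagonal_eq (conjLocal L (IsCMField.complexConj L) v) _ 0 t d rfl]; exact hd0
  have hdet : torusDetNormOne (conjLocal L (IsCMField.complexConj L) v) (cmLocalForm L 3 v) (cmLocalForm_eq_over L 3 v) t = β := by
    apply Subtype.ext
    rw [coe_torusDetNormOne, torusDet_eq_of_glDiagonal_eq (conjLocal L (IsCMField.complexConj L) v) _ t d rfl, Fin.prod_univ_three, hd0, hd1, hd2,
      one_mul, mul_one]
  have ht' : xiTorusChar (conjLocal L (IsCMField.complexConj L) v) (cmLocalForm L 3 v) (cmLocalForm_eq_over L 3 v) (conjLocal_conjLocal_cm L v) 0 μ η₁ η₂ t = 1 := ht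
  rw [xiTorusChar_apply, h0, hdet] at ht'
  simpa only [map_one, one_mul] using ht'

/-- **`η₁(α/σα) = 1` for a unit `α` OF VALUATION ONE at every `w ∣ v`, whenever `χ_ξ = 1` on `T ∩ K_v`, `μ` is unramified and `η₂(α/σα) = 1`**:
the witness `t_α = d(α, 1, σ(α)⁻¹) ∈ T ∩ K_v` has `χ_ξ(t_α) = η₁(α/σα) · μ(α) · ‖α‖^{1/2} · η₂(α/σα)` and `‖α‖^{1/2} = 1` (★ `halfModulusChar_eq_one_of_forall_v_eq_one`).
[cite: Rogawski1990, §12.1 p. 172; §12.2 p. 174] -/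
theorem comp_quotConj_eq_one_of_level_of_v_eq_one (μ : (LocalRing L v)ˣ →* ℂˣ)
    (η₁ η₂ : ↥(normOneUnits (conjLocal L (IsCMField.complexConj L) v)) →* ℂˣ)
    (hμ : ∀ u : (LocalRing L v)ˣ, (∀ w : PlacesOver L v, Valued.v ((u : LocalRing L v) w) = 1) → μ u = 1)
    (hlev : ∀ t : ↥(torusU (conjLocal L (IsCMField.complexConj L) v) (cmLocalForm L 3 v)),
      (t : ↥(unitaryGroupOfForm (conjLocal L (IsCMField.complexConj L) v) (cmLocalForm L 3 v))) ∈ cmLocalIntegralLevel L 3 (qsForm L) v →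
        cmXiTorusChar L v μ η₁ η₂ t = 1)
    (α : (LocalRing L v)ˣ) (hα : ∀ w : PlacesOver L v, Valued.v ((α : LocalRing L v) w) = 1)
    (hη₂ : η₂ (quotConj (conjLocal L (IsCMField.complexConj L) v) (conjLocal_conjLocal_cm L v) α) = 1) :
    η₁ (quotConj (conjLocal L (IsCMField.complexConj L) v) (conjLocal_conjLocal_cm L v) α) = 1 := by
  have hσσ : ∀ x, (conjLocal L (IsCMField.complexConj L) v) ((conjLocal L (IsCMField.complexConj L) v) x) = x := conjLocal_conjLocal_cm L v
  let d : Fin 3 → (LocalRing L v)ˣ := ![α, 1, (Units.map ((conjLocal L (IsCMField.complexConj L) v) : LocalRing L v →* LocalRing L v) α)⁻¹]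
  have hd0 : d 0 = α := rfl
  have hd1 : d 1 = 1 := rfl
  have hd2 : d 2 = (Units.map ((conjLocal L (IsCMField.complexConj L) v) : LocalRing L v →* LocalRing L v) α)⁻¹ := rfl
  have h20 : (conjLocal L (IsCMField.complexConj L) v) (((Units.map ((conjLocal L (IsCMField.complexConj L) v) : LocalRing L v →* LocalRing L v) α)⁻¹ : (LocalRing L v)ˣ) : LocalRing L v) *
      (α : LocalRing L v) = 1 := by
    rw [Units.coe_map_inv, MonoidHom.coe_coe, hσσ, Units.inv_mul]
  have h02 : (conjLocal L (IsCMField.complexConj L) v) (α : LocalRing L v) *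
      (((Units.map ((conjLocal L (IsCMField.complexConj L) v) : LocalRing L v →* LocalRing L v) α)⁻¹ : (LocalRing L v)ˣ) : LocalRing L v) = 1 := by
    rw [Units.coe_map_inv, MonoidHom.coe_coe, ← map_mul, Units.mul_inv, map_one]
  have hmem : glDiagonal 3 (LocalRing L v) d ∈ unitaryGroupOfForm (conjLocal L (IsCMField.complexConj L) v) (cmLocalForm L 3 v) := by
    rw [cmLocalForm_eq_over, glDiagonal_mem_unitaryGroupOfForm_antidiagonal_iff]
    intro i
    fin_cases i
    · show (conjLocal L (IsCMField.complexConj L) v) ((d 2 : (LocalRing L v)ˣ) : LocalRing L v) * (d 0 : LocalRing L v) = 1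
      rw [hd2, hd0]; exact h20
    · show (conjLocal L (IsCMField.complexConj L) v) ((d 1 : (LocalRing L v)ˣ) : LocalRing L v) * (d 1 : LocalRing L v) = 1
      rw [hd1, Units.val_one, map_one, one_mul]
    · show (conjLocal L (IsCMField.complexConj L) v) ((d 0 : (LocalRing L v)ˣ) : LocalRing L v) * (d 2 : LocalRing L v) = 1
      rw [hd2, hd0]; exact h02
  let t : ↥(torusU (conjLocal L (IsCMField.complexConj L) v) (cmLocalForm L 3 v)) := ⟨⟨glDiagonal 3 (LocalRing L v) d, hmem⟩, ⟨d, rfl⟩⟩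
  -- valuations of the three entries: `α`, `1`, `σ(α)⁻¹`
  have hσα : ∀ w : PlacesOver L v,
      Valued.v (((Units.map ((conjLocal L (IsCMField.complexConj L) v) : LocalRing L v →* LocalRing L v) α : (LocalRing L v)ˣ) : LocalRing L v) w) = 1 := by
    intro w
    rw [Units.coe_map, MonoidHom.coe_coe, v_conjLocal_apply]
    exact hα _
  have hval : ∀ (i : Fin 3) (w : PlacesOver L v), Valued.v ((d i : LocalRing L v) w) = 1 := by
    intro i w
    fin_cases i
    · show Valued.v (((d 0 : (LocalRing L v)ˣ) : LocalRing L v) w) = 1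
      rw [hd0]; exact hα w
    · show Valued.v (((d 1 : (LocalRing L v)ˣ) : LocalRing L v) w) = 1
      rw [hd1, Units.val_one, Pi.one_apply, map_one]
    · show Valued.v (((d 2 : (LocalRing L v)ˣ) : LocalRing L v) w) = 1
      rw [hd2]; exact v_units_inv_apply_eq_one L v _ w (hσα w)
  have ht := hlev t (coe_torusU_mem_cmLocalIntegralLevel_of_forall_v_eq_one L v t d rfl hval)
  have h0 : torusEntry (conjLocal L (IsCMField.complexConj L) v) (cmLocalForm L 3 v) 0 t = α := by
    rw [torusEntry_eq_of_glDiagonal_eq (conjLocal L (IsCMField.complexConj L) v) _ 0 t d rfl]; exact hd0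
  have hdet : torusDetNormOne (conjLocal L (IsCMField.complexConj L) v) (cmLocalForm L 3 v) (cmLocalForm_eq_over L 3 v) t = quotConj (conjLocal L (IsCMField.complexConj L) v) hσσ α := by
    apply Subtype.ext
    rw [coe_torusDetNormOne, torusDet_eq_of_glDiagonal_eq (conjLocal L (IsCMField.complexConj L) v) _ t d rfl, Fin.prod_univ_three, coe_quotConj, hd0, hd1, hd2,
      mul_one]
  have ht' : xiTorusChar (conjLocal L (IsCMField.complexConj L) v) (cmLocalForm L 3 v) (cmLocalForm_eq_over L 3 v) hσσ 0 μ η₁ η₂ t = 1 := ht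
  rw [xiTorusChar_apply, h0, hdet, hμ α hα, halfModulusChar_eq_one_of_forall_v_eq_one L v α hα, hη₂, mul_one, mul_one, mul_one] at ht'
  exact ht'

end CM

/-! ## §3 At a NON-SPLIT place: `E¹_v` consists of valuation-one units, so a spherical constituent of `i_G(χ_ξ)` forces `ξ_v = 1` -/

section Nonsplit

variable (L : Type) [Field L] [NumberField L] [IsCMField L] (v : HeightOneSpectrum (𝓞 ↥(maximalRealSubfield L)))
  (hv : ∀ w : PlacesOver L v, IsCMField.complexConj L • w.1 = w.1)

include hv

/-- **At a NON-SPLIT `v`, every `β ∈ E¹_v` has `|β_w|_w = 1` at every (i.e. the) place `w ∣ v`**: `σ(β) · β = 1` componentwise and `|σ(β)_w| = |β_w|`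
(★ `valued_conjLocal_apply_of_smul_eq`), so `|β_w|² = 1` in the ordered value group. [cite: Rogawski1990, §1.9 p. 8; §12.2 p. 174] -/
theorem v_coe_normOneUnits_apply_eq_one_of_nonsplit (β : ↥(normOneUnits (conjLocal L (IsCMField.complexConj L) v))) (w : PlacesOver L v) :
    Valued.v (((β : (LocalRing L v)ˣ) : LocalRing L v) w) = 1 := by
  have h := congrFun ((mem_normOneUnits_iff (β : (LocalRing L v)ˣ)).1 β.2) w
  rw [Pi.mul_apply, Pi.one_apply] at h
  have hv2 := congrArg Valued.v h
  rw [map_mul, map_one, valued_conjLocal_apply_of_smul_eq L v w (hv w)] at hv2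
  exact (pow_eq_one_iff_of_nonneg zero_le two_ne_zero).1 (by rw [pow_two]; exact hv2)

/-- **At a NON-SPLIT `v`, a character of `E¹_v` that is «unramified» in the tree's sense (trivial on the units all of whose `w`-components have valuation one,
★ `isSpherical_cmPrincipalSeries_cmXiTorusChar`'s hypothesis shape) is TRIVIAL**: print's «`ξ_v` unramified» at a non-split `v` is `ξ_v = 1` (`U(1)(L⁺_v) = E¹_v`
is compact). [cite: Rogawski1990, §12.2 p. 174; §13.3] -/
theorem eq_one_of_unramified_normOneUnits_of_nonsplit (η : ↥(normOneUnits (conjLocal L (IsCMField.complexConj L) v)) →* ℂˣ)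
    (hη : ∀ u : ↥(normOneUnits (conjLocal L (IsCMField.complexConj L) v)),
      (∀ w : PlacesOver L v, Valued.v (((u : (LocalRing L v)ˣ) : LocalRing L v) w) = 1) → η u = 1) : η = 1 :=
  MonoidHom.ext fun β => hη β (v_coe_normOneUnits_apply_eq_one_of_nonsplit L v hv β)

/-- **THE DEALT STATEMENT UNDER «EVERYTHING UNRAMIFIED» (incl. `η₁, η₂, η₁′, η₂′`) — no constituent hypothesis is needed**: at a non-split `v` all four characters are
trivial (previous theorem), so `(η₁, η₂) = (η₁′, η₂′)`. [cite: Rogawski1990, §12.2 p. 174; §13.3] -/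
theorem nonsplitXiLabelRigid_of_unramified {η₁ η₂ η₁' η₂' : ↥(normOneUnits (conjLocal L (IsCMField.complexConj L) v)) →* ℂˣ}
    (hη₁ : ∀ u : ↥(normOneUnits (conjLocal L (IsCMField.complexConj L) v)),
      (∀ w : PlacesOver L v, Valued.v (((u : (LocalRing L v)ˣ) : LocalRing L v) w) = 1) → η₁ u = 1)
    (hη₂ : ∀ u : ↥(normOneUnits (conjLocal L (IsCMField.complexConj L) v)),
      (∀ w : PlacesOver L v, Valued.v (((u : (LocalRing L v)ˣ) : LocalRing L v) w) = 1) → η₂ u = 1)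
    (hη₁' : ∀ u : ↥(normOneUnits (conjLocal L (IsCMField.complexConj L) v)),
      (∀ w : PlacesOver L v, Valued.v (((u : (LocalRing L v)ˣ) : LocalRing L v) w) = 1) → η₁' u = 1)
    (hη₂' : ∀ u : ↥(normOneUnits (conjLocal L (IsCMField.complexConj L) v)),
      (∀ w : PlacesOver L v, Valued.v (((u : (LocalRing L v)ˣ) : LocalRing L v) w) = 1) → η₂' u = 1) :
    η₁ = η₁' ∧ η₂ = η₂' := by
  rw [eq_one_of_unramified_normOneUnits_of_nonsplit L v hv η₁ hη₁, eq_one_of_unramified_normOneUnits_of_nonsplit L v hv η₂ hη₂,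
    eq_one_of_unramified_normOneUnits_of_nonsplit L v hv η₁' hη₁', eq_one_of_unramified_normOneUnits_of_nonsplit L v hv η₂' hη₂']
  exact ⟨rfl, rfl⟩

/-- **A `K_v`-SPHERICAL CONSTITUENT OF `i_G(χ_ξ)` FORCES `ξ_v = 1`** at a non-split `v` with `μ` unramified and units-Hilbert-90 `hur` («every `β ∈ E¹_v` is `α/σ(α)` for a unit
`α` of valuation one» — the valuation-currency form of «`L_w/L⁺_v` unramified»): `η₁ = 1 ∧ η₂ = 1` (§2 (S→U), the witnesses `t_β`, `t_α`, and (NS)).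
[cite: Rogawski1990, §12.2 pp. 173–174; §4.5 p. 45] [cite: CartierCorvallis1979, §IV.1] [cite: CasselsFrohlichANT1967, Ch. V §2.7 Prop. 5] -/
theorem eta_eq_one_of_isSpherical_constituent_of_nonsplit
    (hur : ∀ β : ↥(normOneUnits (conjLocal L (IsCMField.complexConj L) v)), ∃ α : (LocalRing L v)ˣ,
      (∀ w : PlacesOver L v, Valued.v ((α : LocalRing L v) w) = 1) ∧ quotConj (conjLocal L (IsCMField.complexConj L) v) (conjLocal_conjLocal_cm L v) α = β)
    (μ : (LocalRing L v)ˣ →* ℂˣ) (hμ : ∀ u : (LocalRing L v)ˣ, (∀ w : PlacesOver L v, Valued.v ((u : LocalRing L v) w) = 1) → μ u = 1)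
    (η₁ η₂ : ↥(normOneUnits (conjLocal L (IsCMField.complexConj L) v)) →* ℂˣ)
    {c : IrrClass (Gqs L v)} (hc : c.IsConstituentOf (cmPrincipalSeries L 3 v (cmXiTorusChar L v μ η₁ η₂)))
    (hK : c.IsSpherical (cmLocalIntegralLevel L 3 (qsForm L) v)) : η₁ = 1 ∧ η₂ = 1 := by
  have hlev := eq_one_of_mem_level_of_isSpherical_constituent L v (cmXiTorusChar L v μ η₁ η₂) hc hK
  have h2 : η₂ = 1 :=
    MonoidHom.ext fun β => eq_one_of_level_of_v_eq_one L v μ η₁ η₂ hlev β (v_coe_normOneUnits_apply_eq_one_of_nonsplit L v hv β)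
  refine ⟨MonoidHom.ext fun β => ?_, h2⟩
  obtain ⟨α, hα, rfl⟩ := hur β
  rw [MonoidHom.one_apply]
  exact comp_quotConj_eq_one_of_level_of_v_eq_one L v μ η₁ η₂ hμ hlev α hα (by rw [h2, MonoidHom.one_apply])

/-- **(LN) UNRAMIFIED NON-SPLIT ξ-LABEL RIGIDITY — THE DEALT HEAD**: at a non-split `v` with `μ` unramified and units-Hilbert-90 `hur` (⟸ `L_w/L⁺_v` unramified), a
class `c ∈ Irr(U(Φ₃)(L⁺_v))` that is a `K_v`-SPHERICAL CONSTITUENT of both `i_G(χ_ξ) = cmPrincipalSeries L 3 v (cmXiTorusChar L v μ η₁ η₂)` and `i_G(χ_{ξ′})` forces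
`(η₁, η₂) = (η₁′, η₂′)` (both labels are `(1, 1)` by the previous theorem; «`P` determines `ξ` at the unramified non-split places», 13.3.7 bookkeeping).
[cite: Rogawski1990, §12.2 pp. 173–174; §13.3] [cite: CartierCorvallis1979, §IV.1] -/
theorem nonsplitXiLabelRigid_unramified
    (hur : ∀ β : ↥(normOneUnits (conjLocal L (IsCMField.complexConj L) v)), ∃ α : (LocalRing L v)ˣ,
      (∀ w : PlacesOver L v, Valued.v ((α : LocalRing L v) w) = 1) ∧ quotConj (conjLocal L (IsCMField.complexConj L) v) (conjLocal_conjLocal_cm L v) α = β)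
    (μ : (LocalRing L v)ˣ →* ℂˣ) (hμ : ∀ u : (LocalRing L v)ˣ, (∀ w : PlacesOver L v, Valued.v ((u : LocalRing L v) w) = 1) → μ u = 1)
    {η₁ η₂ η₁' η₂' : ↥(normOneUnits (conjLocal L (IsCMField.complexConj L) v)) →* ℂˣ} {c : IrrClass (Gqs L v)}
    (hc : c.IsConstituentOf (cmPrincipalSeries L 3 v (cmXiTorusChar L v μ η₁ η₂)))
    (hc' : c.IsConstituentOf (cmPrincipalSeries L 3 v (cmXiTorusChar L v μ η₁' η₂')))
    (hK : c.IsSpherical (cmLocalIntegralLevel L 3 (qsForm L) v)) : η₁ = η₁' ∧ η₂ = η₂' := by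
  obtain ⟨h1, h2⟩ := eta_eq_one_of_isSpherical_constituent_of_nonsplit L v hv hur μ hμ η₁ η₂ hc hK
  obtain ⟨h1', h2'⟩ := eta_eq_one_of_isSpherical_constituent_of_nonsplit L v hv hur μ hμ η₁' η₂' hc' hK
  exact ⟨h1.trans h1'.symm, h2.trans h2'.symm⟩

end Nonsplit

end Summit.HodgeConjecture.HodgeConjecture.R90.S5

end
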